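import Mathlib
import Summits.CriticalPhenomena.CardyFormulaZ2.Theorems.CardyMagicRigidityPositiveConeJointDefs
import Summits.CriticalPhenomena.CardyFormulaZ2.Theorems.CardyMagicRigidityNestingRigidityTreeRigidityTypedReconstruction
import Summits.CriticalPhenomena.CardyFormulaZ2.Theorems.CardyMagicRigidityNestingRigidityCriticalRadii
import HarnessLib

/-!
# Stub `treeRigidityTame_of_tameRigidity`, step (3) at configuration level: typed rigidity on TAME supports

Crux `Summit.CriticalPhenomena.CardyFormulaZ2.Theses.CardyMagicRigidity.NestingRigidity`
(stmt-CriticalPhenomena-4835), line `positive-cone-weight-doubling`, registered helper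
`treeRigidityTame_of_tameRigidity : (tame rigidity) → TreeRigidityTame` (vocabulary of
`Theorems/CardyMagicRigidityPositiveConeJointDefs.lean`, p130599).  This file closes the deterministic
core of its step (3): under the TAME RIGIDITY hypothesis
`∀ u v, Tame u → Tame v → W(u, ·) = W(v, ·) → u = v` (registered neighbour `tame_rigidity`, taken here as
an explicit hypothesis, never asserted), two `Regular` configurations all of whose loops are `Tame` and whose
TYPED two-disc pattern counts agree at positive RATIONAL data (rational centres, radii, windows; every
non-empty surround pattern `S`) are `ε`-close for every `ε ≥ 0`, hence at `cnEDist = 0`.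

* §1 `Tame.reverse` (the class of tame loops is closed under time reversal — the `atMostDouble`
  witness of `u.reverse` is the reversed parametrisation, re-based at `0`), `Tame.degreeOne`, `Tame.sign`,
  and `udist_eq_zero_of_tame_of_interior_eq`: under tame rigidity, `{u | Tame u}` is an INTERIOR-RIGID
  class (`udist_eq_zero_of_windInjective`, p128704).
* §2 `patternCount_eq_of_forall_rat`: for locally finite configurations the pattern counts at RATIONAL
  windows determine those at all real windows (the counted sets are finite, so the window can be shrunk
  to a rational one without losing a counted loop: `exists_lt_subset_ball`).
* §3 `patternCount_pad_eq`: a one-disc surround count is a two-disc pattern count with an inert far disc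
  (pattern `S = {0}`; a disc off the window is avoided by every loop of the window,
  `unbasedLoop_wind_eq_zero_of_subset_ball`).
* §4 `isClose_of_tame_of_typedCounts_eq` (registered anchor) and `cnEDist_eq_zero_of_tame_of_typedCounts_eq`:
  feed §1–§3 into the typed reconstruction theorem `isClose_of_typedCounts_eq` (p130005).
-/

noncomputable section

open MeasureTheory Set Filter Metric
open scoped Real Topology BigOperators ENNReal unitInterval

namespace Summit.CriticalPhenomena.CardyFormulaZ2.Cruxes.NestingRigidity.PositiveConeWeightDoubling

open Literature.Probability.RandomPlanarGeometry Literature.Probability.Percolation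
  Literature.Probability.LatticeModels
open Summit.CriticalPhenomena.CardyFormulaZ2.Theses.CardyMagicRigidity
open Summit.CriticalPhenomena.CardyFormulaZ2.Cruxes.NestingRigidity.RingCloudTomography

/-! ## §1 Tame loops: reversal, degree one, signs; interior rigidity under tame rigidity -/

/-- **The class of tame loops is closed under time reversal.**  The winding function changes sign
(`UnbasedLoop.wind_reverse`), the trace and the winding interior are unchanged, and a parametrisation
without triple points among the parameters of `[0, 1)` reverses to one without triple points (re-base the
reversed parameter `1 - t ∈ (0, 1]` at `0`, using `γ 1 = γ 0`). -/
theorem Tame.reverse {u : UnbasedLoop ℂ} (h : Tame u) : Tame u.reverse := by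
  have hW : ∀ z, u.reverse.wind z = -u.wind z := UnbasedLoop.wind_reverse u
  have hint : {z | u.reverse.wind z ≠ 0} = {z | u.wind z ≠ 0} := by
    ext z
    simp [hW z]
  refine ⟨?_, ?_, ?_, ?_⟩
  · rcases h.signedDegreeOne with h1 | h1
    · refine Or.inr fun z ↦ ?_
      rcases h1 z with h2 | h2 <;> simp [hW z, h2]
    · refine Or.inl fun z ↦ ?_
      rcases h1 z with h2 | h2 <;> simp [hW z, h2]
  · rw [UnbasedLoop.range_reverse, hint]
    exact h.boundary
  · rw [UnbasedLoop.range_reverse, hint]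
    exact h.solid
  · obtain ⟨γ, hγ, hγu, h3⟩ := h.atMostDouble
    refine ⟨γ.reverse, (Curve.isLoop_reverse_iff γ).2 hγ, ?_, ?_⟩
    · rw [← hγu]
      rfl
    · have h01 : γ 1 = γ 0 := (Curve.isLoop_iff.1 hγ).symm
      classical
      -- re-base the reversed parameter at `0`
      set ρ : I → I := fun t ↦ if t = 0 then 0 else σ t with hρ
      have hργ : ∀ t : I, γ (σ t) = γ (ρ t) := by
        intro t
        by_cases ht : t = 0
        · simp only [hρ, ht, if_true, unitInterval.symm_zero]
          exact h01
        · simp only [hρ, ht, if_false]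
      have hpos : ∀ t : I, t ≠ 0 → (0 : ℝ) < t := fun t ht ↦
        lt_of_le_of_ne t.2.1 fun h0 ↦ ht (Subtype.ext h0.symm)
      have hρ1 : ∀ t : I, t < 1 → ρ t < 1 := by
        intro t _
        by_cases h0 : t = 0
        · simp only [hρ, h0, if_true]
          rw [← Subtype.coe_lt_coe, Set.Icc.coe_zero, Set.Icc.coe_one]
          exact zero_lt_one
        · simp only [hρ, h0, if_false]
          rw [← Subtype.coe_lt_coe, unitInterval.coe_symm_eq, Set.Icc.coe_one]
          linarith [hpos t h0]
      have hρinj : ∀ t t' : I, t < 1 → t' < 1 → ρ t = ρ t' → t = t' := by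
        have aux : ∀ t t' : I, t = 0 → t' ≠ 0 → t' < 1 → ρ t = ρ t' → False := by
          intro t t' h0 h0' ht' h
          simp only [hρ, h0, h0', if_true, if_false] at h
          have h1 : ((σ t' : I) : ℝ) = 0 := by rw [← h, Set.Icc.coe_zero]
          rw [unitInterval.coe_symm_eq] at h1
          rw [← Subtype.coe_lt_coe, Set.Icc.coe_one] at ht'
          linarith
        intro t t' ht ht' h
        by_cases h0 : t = 0 <;> by_cases h0' : t' = 0
        · rw [h0, h0']
        · exact (aux t t' h0 h0' ht' h).elim
        · exact (aux t' t h0' h0 ht h.symm).elim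
        · simp only [hρ, h0, h0', if_false] at h
          simpa using congrArg σ h
      intro t₁ t₂ t₃ ht₁ ht₂ ht₃ h12 h23
      simp only [Curve.reverse_apply] at h12 h23
      rw [hργ, hργ] at h12 h23
      rcases h3 (ρ t₁) (ρ t₂) (ρ t₃) (hρ1 _ ht₁) (hρ1 _ ht₂) (hρ1 _ ht₃) h12 h23 with h | h | h
      · exact Or.inl (hρinj _ _ ht₁ ht₂ h)
      · exact Or.inr (Or.inl (hρinj _ _ ht₂ ht₃ h))
      · exact Or.inr (Or.inr (hρinj _ _ ht₁ ht₃ h))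

/-- A tame loop has covering degree one: `W ∈ {0, ±1}`. -/
theorem Tame.degreeOne {u : UnbasedLoop ℂ} (h : Tame u) (z : ℂ) :
    u.wind z = 0 ∨ u.wind z = 1 ∨ u.wind z = -1 := by
  rcases h.signedDegreeOne with h1 | h1 <;> rcases h1 z with h2 | h2 <;> simp [h2]

/-- A tame loop is single-signed: `W ≥ 0` everywhere or `W ≤ 0` everywhere. -/
theorem Tame.sign {u : UnbasedLoop ℂ} (h : Tame u) : (∀ z, 0 ≤ u.wind z) ∨ (∀ z, u.wind z ≤ 0) := by
  rcases h.signedDegreeOne with h1 | h1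
  · exact Or.inl fun z ↦ by rcases h1 z with h2 | h2 <;> simp [h2]
  · exact Or.inr fun z ↦ by rcases h1 z with h2 | h2 <;> simp [h2]

/-- **Under tame rigidity the tame loops form an interior-rigid class**: two tame loops with the same
winding interior are at DKKMO loop distance `d = 0` (equal or time reversals of each other).  This is
`udist_eq_zero_of_windInjective` (p128704) for the reversal-closed (`Tame.reverse`), single-signed
(`Tame.sign`), degree-one (`Tame.degreeOne`) class `{u | Tame u}`, on which the winding function is
injective by hypothesis. -/
theorem udist_eq_zero_of_tame_of_interior_eq
    (hrig : ∀ u v : UnbasedLoop ℂ, Tame u → Tame v → (∀ z, u.wind z = v.wind z) → u = v)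
    {u v : UnbasedLoop ℂ} (hu : Tame u) (hv : Tame v) (h : {z | u.wind z ≠ 0} = {z | v.wind z ≠ 0}) :
    u.udist v = 0 :=
  udist_eq_zero_of_windInjective (𝒞 := {u | Tame u}) (fun u hu v hv huv ↦ hrig u v hu hv huv)
    (fun _ hu ↦ Tame.reverse hu) (fun _ hu ↦ Tame.sign hu) hu hv hu.degreeOne hv.degreeOne h

/-! ## §2 Rational windows suffice for locally finite configurations -/

/-- Finitely many loops inside an open window lie inside a strictly smaller RATIONAL window. -/
theorem exists_rat_lt_forall_range_subset {A : Set (UnbasedLoop ℂ)} (hA : A.Finite) {R : ℝ}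
    (h : ∀ u ∈ A, u.range ⊆ ball (0 : ℂ) R) :
    ∃ R' : ℚ, (R' : ℝ) < R ∧ ∀ u ∈ A, u.range ⊆ ball (0 : ℂ) R' := by
  have hK : IsCompact (⋃ u ∈ A, u.range) := hA.isCompact_biUnion fun u _ ↦ u.isCompact_range
  have hKsub : (⋃ u ∈ A, u.range) ⊆ ball (0 : ℂ) R := iUnion₂_subset h
  obtain ⟨R₀, hR₀, hK₀⟩ := exists_lt_subset_ball hK.isClosed hKsub
  obtain ⟨R', h1, h2⟩ := exists_rat_btwn hR₀
  refine ⟨R', h2, fun u hu ↦ ?_⟩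
  exact (subset_iUnion₂ (s := fun u (_ : u ∈ A) ↦ u.range) u hu).trans
    (hK₀.trans (ball_subset_ball h1.le))

/-- **Pattern counts at rational windows determine those at all windows**, for locally finite
configurations and a non-degenerate surrounded disc `i ∈ S`: the two counted sets at the window `R` are
finite (`finite_patternLoops_of_isLocallyFinite`), so they are already counted at some rational window
`R' < R`. -/
theorem patternCount_eq_of_forall_rat {c c' : LoopConfig ℂ} (hc : c.IsLocallyFinite)
    (hc' : c'.IsLocallyFinite) {n : ℕ} (x : Fin n → ℂ) (r : Fin n → ℝ) (S : Finset (Fin n)) {i : Fin n}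
    (hi : i ∈ S) (hri : 0 < r i)
    (h : ∀ R : ℚ, patternCount c x r R S = patternCount c' x r R S) (R : ℝ) :
    patternCount c x r R S = patternCount c' x r R S := by
  -- the counted sets at window `T` of a configuration `d`
  set P : LoopConfig ℂ → ℝ → Set (UnbasedLoop ℂ) := fun d T ↦
    {u ∈ d.loops | u.range ⊆ ball (0 : ℂ) T ∧ (∀ i ∈ S, closedBall (x i) (r i) ⊆ {w | u.wind w ≠ 0}) ∧
      ∀ i, i ∉ S → Disjoint (closedBall (x i) (r i)) ({w | u.wind w ≠ 0} ∪ u.range)} with hP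
  have hcount : ∀ (d : LoopConfig ℂ) (T : ℝ), patternCount d x r T S = (P d T).ncard := fun _ _ ↦ rfl
  have hAf : (P c R).Finite := finite_patternLoops_of_isLocallyFinite hc x r R S hi hri
  have hA'f : (P c' R).Finite := finite_patternLoops_of_isLocallyFinite hc' x r R S hi hri
  obtain ⟨R', hR'R, hR'⟩ := exists_rat_lt_forall_range_subset (hAf.union hA'f) (R := R) fun u hu ↦ by
    rcases hu with hu | hu
    · exact hu.2.1
    · exact hu.2.1
  have key : ∀ d : LoopConfig ℂ, (∀ u ∈ P d R, u.range ⊆ ball (0 : ℂ) R') → P d R' = P d R := by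
    intro d hd
    refine (patternLoops_mono d x S (fun _ ↦ le_rfl) hR'R.le).antisymm fun u hu ↦ ?_
    exact ⟨hu.1, hd u hu, hu.2.2⟩
  rw [hcount, hcount, ← key c fun u hu ↦ hR' u (Or.inl hu), ← key c' fun u hu ↦ hR' u (Or.inr hu),
    ← hcount, ← hcount]
  exact h R'

/-! ## §3 One-disc counts as padded two-disc pattern counts -/

/-- **A far disc is inert**: the one-disc surround count in the window `B(0, R)` equals the two-disc
pattern count with pattern `S = {0}` once the second (closed) disc misses the window — every loop of the
window avoids it, interior (`unbasedLoop_wind_eq_zero_of_subset_ball`) and trace. -/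
theorem patternCount_pad_eq (c : LoopConfig ℂ) (z z' : ℂ) (ρ ρ' R : ℝ)
    (hfar : Disjoint (closedBall z' ρ') (ball (0 : ℂ) R)) :
    patternCount c ![z, z'] ![ρ, ρ'] R {0} = patternCount c ![z] ![ρ] R Finset.univ := by
  unfold patternCount
  congr 1
  ext u
  simp only [mem_setOf_eq, Finset.mem_singleton, Finset.mem_univ, forall_const, not_true_eq_false,
    IsEmpty.forall_iff, and_true, forall_eq, Matrix.cons_val_zero]
  constructor
  · rintro ⟨hu, hR, hsur, -⟩
    refine ⟨hu, hR, fun i ↦ ?_⟩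
    fin_cases i
    simpa using hsur
  · rintro ⟨hu, hR, hsur⟩
    refine ⟨hu, hR, by simpa using hsur 0, fun i hi ↦ ?_⟩
    obtain rfl : i = 1 := by
      fin_cases i
      · simp at hi
      · rfl
    simp only [Matrix.cons_val_one, Matrix.cons_val_fin_one]
    refine hfar.mono_right (union_subset (fun w hw ↦ ?_) hR)
    by_contra hw'
    rw [mem_ball, not_lt] at hw'
    exact hw (unbasedLoop_wind_eq_zero_of_subset_ball u hR hw')

/-- The far disc `B̄((R + 2, 0), 1)` misses the window `B(0, R)`. -/
theorem disjoint_closedBall_far_ball (R : ℝ) :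
    Disjoint (closedBall (⟨R + 2, 0⟩ : ℂ) 1) (ball (0 : ℂ) R) := by
  rw [Set.disjoint_left]
  intro w hw hw'
  rw [mem_closedBall] at hw
  rw [mem_ball, dist_zero_right] at hw'
  have h1 : ‖(⟨R + 2, 0⟩ : ℂ)‖ = |R + 2| := by
    simp [Complex.norm_def, Complex.normSq_apply, Real.sqrt_mul_self_eq_abs]
  have h2 : ‖(⟨R + 2, 0⟩ : ℂ)‖ ≤ ‖w‖ + dist w ⟨R + 2, 0⟩ := by
    have := norm_le_norm_add_norm_sub' (⟨R + 2, 0⟩ : ℂ) w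
    rwa [← dist_eq_norm, dist_comm] at this
  have h3 : R + 2 ≤ |R + 2| := le_abs_self _
  linarith

/-! ## §4 Typed rigidity on tame supports (registered anchor) -/

/-- Componentwise cast of a `2`-vector of rational centres. -/
private theorem ratVec2 (q q' : ℚ × ℚ) :
    (fun j ↦ (⟨((![q, q'] j).1 : ℝ), ((![q, q'] j).2 : ℝ)⟩ : ℂ)) = ![(⟨q.1, q.2⟩ : ℂ), ⟨q'.1, q'.2⟩] := by
  funext j
  fin_cases j <;> rfl

/-- Componentwise cast of a `2`-vector of rational radii. -/
private theorem ratVec2' (s s' : ℚ) : (fun j ↦ ((![s, s'] j : ℚ) : ℝ)) = ![(s : ℝ), s'] := by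
  funext j
  fin_cases j <;> rfl

/-- **Typed rigidity on tame supports (configuration level; registered anchor).**  Assume TAME RIGIDITY
(`∀ u v, Tame u → Tame v → W(u,·) = W(v,·) → u = v`, the registered neighbour `tame_rigidity`).  Let
`c`, `c'` be `Regular` configurations all of whose loops are `Tame`, and suppose their TYPED two-disc
pattern counts (`typedPatternCount`, p130599) agree at every positive rational datum: rational centres,
positive rational radii, rational window, every non-empty pattern `S ⊆ {0, 1}`, both types.  Then
`d_CN(c, c') ≤ ε` in DKKMO's printed sense for every `ε ≥ 0`.  Proof: one-disc counts are padded two-disc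
counts (§3), rational windows suffice (§2, per type via `regular_typeRestrict`), tame loops are
interior-rigid (§1), and `isClose_of_typedCounts_eq` (p130005) reconstructs. -/
theorem isClose_of_tame_of_typedCounts_eq :
    (∀ u v : UnbasedLoop ℂ, Tame u → Tame v → (∀ z, u.wind z = v.wind z) → u = v) →
    ∀ {c c' : LoopConfig ℂ}, Regular c → Regular c' → (∀ u ∈ c.loops, Tame u) →
    (∀ u ∈ c'.loops, Tame u) →
    (∀ (i : Fin 2) (x : Fin 2 → ℚ × ℚ) (r : Fin 2 → ℚ) (R : ℚ) (S : Finset (Fin 2)),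
      (∀ j, 0 < r j) → S.Nonempty →
      typedPatternCount c i (fun j ↦ (⟨(x j).1, (x j).2⟩ : ℂ)) (fun j ↦ (r j : ℝ)) R S =
        typedPatternCount c' i (fun j ↦ (⟨(x j).1, (x j).2⟩ : ℂ)) (fun j ↦ (r j : ℝ)) R S) →
    ∀ ε : ℝ, 0 ≤ ε → LoopConfig.IsClose ε c c' := by
  intro hrig c c' hc hc' ht ht' h ε hε
  -- local finiteness of the single-type parts
  have hlf : ∀ i, (⟨fun j ↦ if j = i then c.F i else ∅⟩ : LoopConfig ℂ).IsLocallyFinite :=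
    fun i ↦ (regular_typeRestrict hc i).locallyFinite
  have hlf' : ∀ i, (⟨fun j ↦ if j = i then c'.F i else ∅⟩ : LoopConfig ℂ).IsLocallyFinite :=
    fun i ↦ (regular_typeRestrict hc' i).locallyFinite
  refine isClose_of_typedCounts_eq (𝒞 := {u | Tame u})
    (fun u hu v hv huv ↦ udist_eq_zero_of_tame_of_interior_eq hrig hu hv huv) hc hc' ht ht'
    (fun i R q s hs ↦ ?_) (fun i R q q' s s' hs hs' _ ↦ ?_) ε hε
  · -- one disc: pad with the far disc `B̄((R' + 2, 0), 1)` at rational windows `R'`, then all windows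
    refine patternCount_eq_of_forall_rat (hlf i) (hlf' i) _ _ Finset.univ (i := 0) (Finset.mem_univ _)
      (by simpa using hs) (fun R' ↦ ?_) R
    have hfar := disjoint_closedBall_far_ball (R' : ℝ)
    rw [← patternCount_pad_eq _ _ (⟨(R' : ℝ) + 2, 0⟩ : ℂ) _ 1 _ hfar,
      ← patternCount_pad_eq _ _ (⟨(R' : ℝ) + 2, 0⟩ : ℂ) _ 1 _ hfar]
    have key := h i ![q, (R' + 2, 0)] ![s, 1] R' {0}
      (fun j ↦ by fin_cases j <;> simp [hs]) ⟨0, Finset.mem_singleton_self 0⟩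
    rw [typedPatternCount, typedPatternCount, ratVec2, ratVec2'] at key
    simpa only [Rat.cast_add, Rat.cast_ofNat, Rat.cast_one, Rat.cast_zero] using key
  · -- two discs: rational windows, then all windows
    refine patternCount_eq_of_forall_rat (hlf i) (hlf' i) _ _ Finset.univ (i := 0) (Finset.mem_univ _)
      (by simpa using hs) (fun R' ↦ ?_) R
    have key := h i ![q, q'] ![s, s'] R' Finset.univ
      (fun j ↦ by fin_cases j <;> simp [hs, hs']) Finset.univ_nonempty
    rw [typedPatternCount, typedPatternCount, ratVec2, ratVec2'] at key
    exact key

/-- **Typed reconstruction on tame supports, `cnEDist` form**: under the hypotheses of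
`isClose_of_tame_of_typedCounts_eq`, `cnEDist c c' = 0`. -/
theorem cnEDist_eq_zero_of_tame_of_typedCounts_eq
    (hrig : ∀ u v : UnbasedLoop ℂ, Tame u → Tame v → (∀ z, u.wind z = v.wind z) → u = v)
    {c c' : LoopConfig ℂ} (hc : Regular c) (hc' : Regular c') (ht : ∀ u ∈ c.loops, Tame u)
    (ht' : ∀ u ∈ c'.loops, Tame u)
    (h : ∀ (i : Fin 2) (x : Fin 2 → ℚ × ℚ) (r : Fin 2 → ℚ) (R : ℚ) (S : Finset (Fin 2)),
      (∀ j, 0 < r j) → S.Nonempty →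
      typedPatternCount c i (fun j ↦ (⟨(x j).1, (x j).2⟩ : ℂ)) (fun j ↦ (r j : ℝ)) R S =
        typedPatternCount c' i (fun j ↦ (⟨(x j).1, (x j).2⟩ : ℂ)) (fun j ↦ (r j : ℝ)) R S) :
    LoopConfig.cnEDist c c' = 0 :=
  cnEDist_eq_zero_of_forall_isClose fun ε hε ↦
    isClose_of_tame_of_typedCounts_eq hrig hc hc' ht ht' h ε hε.le

end Summit.CriticalPhenomena.CardyFormulaZ2.Cruxes.NestingRigidity.PositiveConeWeightDoubling

end
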